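import Summits.BirchSwinnertonDyer.BirchSwinnertonDyer.Theorems.GoldfeldAllTwistsTwoConverseTwinGenusRankOneDescent
import HarnessLib

set_option linter.dupNamespace false
set_option autoImplicit false

/-!
# LINE B49, genus assembly, family F2 (`d_K = −8q`), step W-A2′ part II(a): the genus field `K(r₀) = K(θ₀)`,
# `θ₀² = −2` — descent of the genus point `P_χ` and its anti-invariance under `Gal(K(θ₀)/K)`

Cell `bsd-goldfeld`, seat `bsd-goldfeld-s1p-c3` (prover, gen 8); memo `HOME/B49-GENUS.md` §1 (family F2: `D = −8q`,
`q ≡ 1 (mod 4)`, genus field `H₀ = K(√q) = K(√−2)`), the F2 analogue of `…TwinGenusRankOneDescent` (family F1, where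
`H₀ = K(i)`). Support for item `stmt-BirchSwinnertonDyer-19140` (crux twin″; joint with 20044 K12₂″). Theorems only.
HONEST FRAMING: BSD is not proved by any of this; pure field theory and point bookkeeping — no `L`-value, no
named fact.

THE ARGUMENT. `K` imaginary quadratic with `d_K = −8q` (`q` prime); `L/K` finite Galois (the Hilbert class field),
`r₀ ∈ L` with `r₀² = q`, `y₁ ∈ X₀(49)(L)`; `P_χ = Σ_σ χ(σ)•σy₁`, `χ(σ) = ±1` as `σr₀ = ±r₀`. (1) `P_χ` descends to
`y_χ ∈ X₀(49)(H₀)`, `H₀ = K(r₀)` (gen 6, `exists_map_adjoin_eq_twistedSum`). (2) `H₀ = K(θ₀)` with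
`θ₀ = δ r₀/(2q)`, `δ² = d_K = −8q`, so `θ₀² = −2` and `r₀ = −(δ/4)·θ₀`; the non-trivial `K`-automorphism `σ₀` of `H₀`
(`Quadratic.conj`, `σ₀ θ₀ = −θ₀`, hence `σ₀ r₀ = −r₀`) lifts to `τ ∈ Gal(L/K)` (`AlgHom.liftNormal`) with
`τ r₀ = −r₀`, and `τ P_χ = −P_χ` (gen 7's `map_twistedSum_eq_neg_of_apply_eq_neg`), so `σ₀ y_χ = −y_χ`. This is
exactly the input of the twist by `θ₀` (`c = −2`: the F2 partner `49a1^{(−2)} = 3136⁻`) in the (RO′) step of the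
F2 chain. Main statement: `exists_genusField_data_negEight`.

References: B. Gross, in *Modular forms* (1984) §§4–5 [Gross1984]; J. Coates, Y. Li, Y. Tian, S. Zhai, PLMS 110
(2015) (2.8) [CoatesLiTianZhai2015]; D. A. Cox, *Primes of the form x² + ny²* (2013) §6.A Thm 6.1 [Cox2013].
-/

noncomputable section

open scoped Classical IntermediateField

open WeierstrassCurve Literature.NumberTheory.EllipticCurves
  Literature.NumberTheory.EllipticCurves.ModularForms

namespace Summit.BirchSwinnertonDyer.BirchSwinnertonDyer.Theorems.GoldfeldGoodTwists

section GenusFieldNegEight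

variable {K : Type} [Field K] [NumberField K] {L : Type*} [Field L] [CharZero L] [Algebra K L]
  [FiniteDimensional K L] [IsGalois K L]

/-- `q` is not a square in `K = ℚ(√−2q)` (`d_K = −8q`, `q` prime): else `q` or `q·d_K = −8q² < 0` would be a
rational square. [folklore] -/
theorem not_isSquare_natCast_of_discr_eq_negEight (hK : IsImaginaryQuadratic K) {q : ℕ} (hq : q.Prime)
    (hdK : NumberField.discr K = -(8 * (q : ℤ))) : ¬ IsSquare ((q : ℕ) : K) := by
  intro h
  have h' : IsSquare (algebraMap ℚ K (q : ℚ)) := by rwa [map_natCast]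
  rcases isSquare_or_of_isSquare_algebraMap_rat hK h' with h1 | h1
  · exact not_isSquare_prime hq (Rat.isSquare_natCast_iff.mp h1)
  · refine not_isSquare_of_neg ?_ h1
    rw [hdK]; push_cast
    have : (0 : ℚ) < q := by exact_mod_cast hq.pos
    nlinarith

/-- **The genus-field data for family F2.** For `K` imaginary quadratic with `d_K = −8q` (`q` prime), `L/K` finite
Galois, `r₀ ∈ L` with `r₀² = q` and `y₁ ∈ X₀(49)(L)`: with `H₀ = K⟮r₀⟯` (degree `2`) there are `θ₀ ∈ H₀` with
`θ₀² = −2`, `θ₀ ∉ K`, and a point `y_χ ∈ X₀(49)(H₀)` mapping to the twisted sum `P_χ = Σ_σ χ(σ)•σy₁` and NEGATED by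
the non-trivial `K`-automorphism of `H₀` (`Quadratic.conj`, `θ₀ ↦ −θ₀`): the conjugation lifts to `τ ∈ Gal(L/K)`
(`AlgHom.liftNormal`) with `τ r₀ = −r₀` (`r₀ = −(δ/4)·θ₀`, `δ² = d_K`, `θ₀ = δr₀/(2q)`), and `τ P_χ = −P_χ`.
[cite: Gross1984, §§4–5] [cite: CoatesLiTianZhai2015, (2.8)] [cite: Cox2013, §6.A Thm. 6.1] -/
theorem exists_genusField_data_negEight (hK : IsImaginaryQuadratic K) {q : ℕ} (hq : q.Prime)
    (hdK : NumberField.discr K = -(8 * (q : ℤ))) {r₀ : L} (hr : r₀ ^ 2 = algebraMap K L ((q : ℕ) : K))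
    (y₁ : (cm7.baseChange L).toAffine.Point) :
    ∃ (θ₀ : K⟮r₀⟯) (hfin : Module.finrank K K⟮r₀⟯ = 2) (hθ : (θ₀ : K⟮r₀⟯) ∉ Set.range (algebraMap K K⟮r₀⟯))
      (hi : θ₀ ^ 2 = algebraMap K K⟮r₀⟯ (-2)) (yχ : (cm7.baseChange K⟮r₀⟯).toAffine.Point),
      (θ₀ : L) ^ 2 = -2 ∧
      Affine.Point.map (algebraMap K⟮r₀⟯ L).toRatAlgHom yχ =
        ∑ σ : L ≃ₐ[K] L, (if σ r₀ = r₀ then (1 : ℤ) else -1) • Affine.Point.map (σ : L →ₐ[K] L) y₁ ∧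
      Affine.Point.map (W' := cm7) (Literature.NumberTheory.QuadraticFields.Quadratic.conj hfin hθ hi) yχ = -yχ := by
  -- arithmetic of the family
  have hqK : ¬ IsSquare ((q : ℕ) : K) := not_isSquare_natCast_of_discr_eq_negEight hK hq hdK
  have hfin : Module.finrank K K⟮r₀⟯ = 2 := finrank_adjoin_sqrt_eq_two (L := L) hr hqK
  have hq0 : (q : L) ≠ 0 := by exact_mod_cast hq.ne_zero
  have h2L : (2 : L) ≠ 0 := two_ne_zero
  have hr' : r₀ ^ 2 = (q : L) := by rw [hr, map_natCast]
  have hr0 : r₀ ≠ 0 := by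
    intro h; rw [h, zero_pow two_ne_zero] at hr'; exact hq0 hr'.symm
  -- `δ ∈ K` with `δ² = d_K = −8q`, and `θ₀ = δ r₀ / (2q)`
  obtain ⟨δ, hδ, -, -⟩ := exists_sq_eq_discr_and_span hK
  have hδK : δ ^ 2 = -(8 * (q : K)) := by
    rw [hδ, hdK]; simp [map_neg, map_mul, map_ofNat, map_natCast]
  have hδL : (algebraMap K L δ) ^ 2 = -(8 * (q : L)) := by
    rw [← map_pow, hδK]; simp [map_neg, map_mul, map_ofNat, map_natCast]
  have hδ0 : algebraMap K L δ ≠ 0 := by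
    intro h; rw [h, zero_pow two_ne_zero] at hδL
    exact hq0 (by linear_combination hδL / 8)
  obtain ⟨iL, hiL⟩ : ∃ x : L, x = algebraMap K L δ * r₀ / (2 * q) := ⟨_, rfl⟩
  have hiL2 : iL ^ 2 = -2 := by
    rw [hiL, div_pow, mul_pow, hδL, hr']; field_simp; ring
  have hi_mem : iL ∈ K⟮r₀⟯ := by
    rw [hiL]
    refine div_mem (mul_mem (IntermediateField.algebraMap_mem _ δ)
      (IntermediateField.mem_adjoin_simple_self K r₀)) ?_
    exact_mod_cast (natCast_mem K⟮r₀⟯ (2 * q))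
  obtain ⟨i₀, hi₀⟩ : ∃ i : K⟮r₀⟯, i = ⟨iL, hi_mem⟩ := ⟨_, rfl⟩
  have hi₀L : (i₀ : L) = iL := by rw [hi₀]
  have hi : i₀ ^ 2 = algebraMap K K⟮r₀⟯ (-2) := by
    apply Subtype.ext
    simp [hi₀L, hiL2, map_ofNat]
    norm_cast
  -- `r₀ = b·θ₀` with `b = −δ/4 ∈ K`
  obtain ⟨b, hb⟩ : ∃ b : K, b = -(δ / 4) := ⟨_, rfl⟩
  have hr_eq : algebraMap K L b * iL = r₀ := by
    have h8q : (8 : L) * q ≠ 0 := mul_ne_zero (by norm_num) hq0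
    rw [hb, hiL, map_neg, map_div₀, map_ofNat]
    have : -(algebraMap K L δ / 4) * (algebraMap K L δ * r₀ / (2 * q)) =
        -(algebraMap K L δ ^ 2) * r₀ / (8 * q) := by ring
    rw [this, hδL, neg_neg, mul_div_cancel_left₀ r₀ h8q]
  have hθ : (i₀ : K⟮r₀⟯) ∉ Set.range (algebraMap K K⟮r₀⟯) := by
    rintro ⟨κ, hκ⟩
    have hκL : algebraMap K L κ = iL := by
      have := congrArg Subtype.val hκ
      rw [hi₀L] at this
      simpa using this
    apply algebraMap_ne_sqrt_of_not_isSquare hr hqK (b * κ)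
    rw [map_mul, hκL, hr_eq]
  -- the descended twisted sum
  obtain ⟨yχ, hyχ⟩ := exists_map_adjoin_eq_twistedSum cm7 (k := K) hr y₁
  -- the conjugation of `H₀/K` and its lift to `Gal(L/K)`
  haveI : Normal K L := inferInstance
  obtain ⟨τ, hτ⟩ : ∃ τ : L ≃ₐ[K] L, τ = AlgEquiv.ofBijective
      ((Literature.NumberTheory.QuadraticFields.Quadratic.conj hfin hθ hi).liftNormal L)
      (AlgHom.normal_bijective K L L _) := ⟨_, rfl⟩
  have hτcomm : ∀ x : K⟮r₀⟯, τ (algebraMap K⟮r₀⟯ L x) =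
      algebraMap K⟮r₀⟯ L (Literature.NumberTheory.QuadraticFields.Quadratic.conj hfin hθ hi x) := fun x ↦ by
    rw [hτ]; exact (Literature.NumberTheory.QuadraticFields.Quadratic.conj hfin hθ hi).liftNormal_commutes L x
  have hrr : (⟨r₀, IntermediateField.mem_adjoin_simple_self K r₀⟩ : K⟮r₀⟯) =
      algebraMap K K⟮r₀⟯ b * i₀ := by
    apply Subtype.ext
    simp [hi₀L, hr_eq]
  have hτr : τ r₀ = -r₀ := by
    have h1 := hτcomm (algebraMap K K⟮r₀⟯ b * i₀)
    rw [Literature.NumberTheory.QuadraticFields.Quadratic.conj_mul_gen, map_neg, ← hrr] at h1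
    simpa using h1
  refine ⟨i₀, hfin, hθ, hi, yχ, by rw [hi₀L, hiL2], hyχ, ?_⟩
  -- anti-invariance: compare in `X₀(49)(L)`
  apply Affine.Point.map_injective (W' := cm7) (f := (algebraMap K⟮r₀⟯ L).toRatAlgHom)
  have step1 : ∀ P : (cm7.baseChange K⟮r₀⟯).toAffine.Point,
      Affine.Point.map (algebraMap K⟮r₀⟯ L).toRatAlgHom
        (Affine.Point.map (W' := cm7) (Literature.NumberTheory.QuadraticFields.Quadratic.conj hfin hθ hi) P) =
      Affine.Point.map (τ : L →ₐ[K] L) (Affine.Point.map (algebraMap K⟮r₀⟯ L).toRatAlgHom P) := by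
    intro P
    rcases P with _ | ⟨x, y, hxy⟩
    · rfl
    · simp only [Affine.Point.map_some, Affine.Point.some.injEq]
      exact ⟨by simpa using (hτcomm x).symm, by simpa using (hτcomm y).symm⟩
  rw [step1, map_neg, hyχ, map_twistedSum_eq_neg_of_apply_eq_neg cm7 τ hr hr0 h2L hτr y₁]

end GenusFieldNegEight

end Summit.BirchSwinnertonDyer.BirchSwinnertonDyer.Theorems.GoldfeldGoodTwists

end
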